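import Summits.HodgeConjecture.HodgeConjecture.Theorems.Ring2AbelianAllAndreFibreClassDivisionNodes
import HarnessLib

/-!
# Ring 2 · sub-cell AbelianAll (ALL ABELIAN VARIETIES), André axis, part XXIX-e — (Div) IS EXACT: at every fibre satisfying the
# Hodge conjecture, division by the fibre class in all degrees ⟺ the lift in all degrees; hence `HC_CM ⊢ Div^CM ⟺ (L)`, and
# `HC_AV ⟺ HC_CM ∧ Div^CM` granted Lemme 6.3.1 and Verdier — by DUALITY ON THE TOTAL SPACE, no rationality bookkeeping

HONEST FRAMING (page 1, verbatim): **research route, not a corollary; conditional on HC_CM plus one named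
minimal statement.** Cell line: research route conditional on HC_CM; not a corollary; Q11.4-sentence-2
already refuted in dim ≥ 3. Nothing in this file proves a case of the Hodge conjecture for an abelian variety.
`HC_CM` = `Theses.RankFourFaces.CMAbelianHodge` is a BINDER wherever it occurs; `HC_AV` = `Theses.PadicSemiregularLift.HodgeAbelianVarieties`;
Verdier = the Literature named fact `Motives.Verdier1976_genericLocalTriviality` (a binder); item `Theses.RankFourFaces.CMToAbelian`
(stmt-HodgeConjecture-16267) OPEN and not closed here. Seat `pub-hodge-ring2-ab-andre-2`, gen 21; continuation of parts XXIX-a…d.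

## The point

(Div)_t(p) ⟹ (L)_t(p) (part XXIX-c). Conversely, part XXIX-a obtained (Div)_t(p) from the two total-space statements (Num₁)(p,q),
(Num₂)(p,q) (`p + q = d`). Part XVIII-c already showed (Num₁)(p,q) = (Num_t)(p,q) ⟸ `HC^p(𝒳_t) ∧ (L)_t(p)` by duality on `𝒳`
(`numerical_of_comap_le_sup_of_hodge`). THE SAME DUALITY gives **(Num₂)(p,q) ⟸ `HC^q(𝒳_t) ∧ (L)_t(q)`** (§1): an algebraic class
`L_t x` lies in `span_ℂ Hdg^{p+1}(𝒳)`, which pairs perfectly with `span_ℂ Hdg^q(𝒳)` (part XVIII-b); a Hodge `ξ` of degree `2q`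
restricts to a Hodge, hence (by `HC^q(𝒳_t)`) algebraic class of the fibre, so by (L)_t(q) `ξ = a + κ` with `a` algebraic and
`j_t^* κ = 0`; then `⟪L_t x, ξ⟫ = ⟪L_t x, a⟫ + ⟪x, L_t κ⟫ = 0 + 0`. Hence **at a fibre where the Hodge conjecture holds in degrees
`2p` and `2q`: Div[t,p] ⟸ (L)_t(p) ∧ (L)_t(q)**, and **[∀ p, Div[t,p]] ⟺ [∀ p, (L)_t(p)]** (§2); at the CM fibres under `HC_CM`
(§3) the displayed bracket "(Div) at the CM points of the CM-pointed compact abelian pencils" is EQUIVALENT to the lift node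
`CMFibreAlgebraicLift`, so it inherits its exactness (part XX-a): `HC_AV ⟹ Div^CM` granted Verdier, and
**`HC_AV ⟺ HC_CM ∧ Div^CM`** granted Lemme 6.3.1 and Verdier. No habitat clause is needed (contrast the idempotent package of
part XXVIII, exact only in the habitat): division asks nothing of the invariant classes that are not algebraic.

## What is proved (theorems only; no definition, no named fact, no sorry)

§1 **`numerical₂_of_comap_le_sup_of_hodge`** (`HC^q(𝒳_t) ∧ (L)_t(q) ⟹ (Num₂)(p,q)`).
§2 **`fibreClassDivisionAt_of_comap_le_sup_pair_of_hodge`** (`HC^p, HC^q` at `𝒳_t`: `(L)_t(p) ∧ (L)_t(q) ⟹ Div[t,p]`);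
`fibreClassDivisionAt_iff_comap_le_sup_of_hodge`; **`forall_fibreClassDivisionAt_iff_forall_comap_le_sup_of_hodge`**.
§3 `forall_fibreClassDivisionAt_iff_forall_comap_le_sup_of_HC_CM` (CM fibres, `HC_CM` binder);
**`fibreClassDivisionCM_iff_cmFibreAlgebraicLift_of_HC_CM`** (`HC_CM ⊢ Div^CM ⟺ (L)`); `fibreClassDivisionCM_of_HC_AV_of_verdier`;
**`HC_AV_iff_HC_CM_and_fibreClassDivisionCM_of_verdier`**; `cmToAbelian_iff_HC_CM_imp_fibreClassDivisionCM_of_verdier`.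

## Honest status

Nothing here is fact-free progress on `HC_AV`; no node is born (Div^CM is written out, not defined); nothing is minimal — Div^CM is
one more typed form of the André-axis `B_min`, kernel-equivalent under `HC_CM` to (L) = `CMFibreAlgebraicLift` (hence to Num^CM,
(Prim)^CM, the top-weight forms …), strictly between (β′)/(A_f) and (L) in the absence of `HC_CM` as far as the kernel knows.

References: Kleiman1968AlgebraicCycles (§3); Andre1996Motifs (§5.1, §6.3 a), Lemme 6.3.1, Remarque 2); Milne2020HodgeClassesAV (Prop. 1
p. 7); VoisinHodgeI2002 (Thm. 6.32, §7.1.2, Thm. 11.30); Verdier1976 (Cor. (5.1)); HatcherAT2002 (§3.2 Thm. 3.11, §3.3 Prop. 3.38).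
-/

noncomputable section

set_option linter.dupNamespace false

namespace Summit.HodgeConjecture.HodgeConjecture.Ring2.AbelianAll

open CategoryTheory AlgebraicGeometry
open Literature.AlgebraicGeometry Literature.AlgebraicGeometry.Motives
open Literature.AlgebraicGeometry.HodgeTheory
open Literature.AlgebraicTopology.SingularHomology (singularCohomology cupProduct)
open Literature.AlgebraicGeometry.Deligne1982 (cmLocus)
open Literature.AlgebraicGeometry.Andre1996 (andre1996_cmAnchoredPencil)
open Summit.HodgeConjecture.HodgeConjecture
open Summit.HodgeConjecture.HodgeConjecture.Theses
open Summit.HodgeConjecture.HodgeConjecture.Ring2.Deform (HC_CM_of_HC_AV)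

variable {𝒳 S : SchemeOver ℂ} {d : ℕ} {f : 𝒳 ⟶ S}

/-- The display-only bracket of part XXIX-c (re-declared locally; notation, census-invisible): `Div[hf, t, p]` iff
`L_t⁻¹ N^{p+1}(𝒳) ≤ N^p(𝒳) + ker j_t^*`, `L_t = j_{t*} j_t^*`. [cite: Grothendieck1968, §3 p. 196 (A(X, L))]
[cite: Abdulali1994FamiliesAV, Conjecture 5.3 (p. 1130)] -/
local notation3 "Div[" hf ", " t ", " p "]" =>
  Submodule.comap ((fiberGysin hf t p) ∘ₗ (complexBetti.map (fiberι f t) (2 * p)).hom) (algebraicClasses 𝒳 (p + 1)) ≤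
    algebraicClasses 𝒳 p ⊔ LinearMap.ker (complexBetti.map (fiberι f t) (2 * p)).hom

/-! ## §1 (Num₂) from the lift in the complementary degree and the Hodge conjecture there, by duality on `𝒳` -/

/-- **`HC^q(𝒳_t) ∧ (L)_t(q) ⟹ (Num₂)(p,q)`** (`p + q = d`): an ALGEBRAIC class `L_t x = x ∪ [𝒳_t]` (`x ∈ H^{2p}(𝒳(ℂ); ℂ)`)
cup-orthogonal to `N^q(𝒳)` vanishes. Proof: `L_t x ∈ span_ℂ Hdg^{p+1}(𝒳)`, which pairs perfectly with `span_ℂ Hdg^q(𝒳)` (part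
XVIII-b); for `ξ ∈ span_ℂ Hdg^q(𝒳)`, `j_t^* ξ` is algebraic on the fibre (`HC^q(𝒳_t)`), so `ξ = a + κ` with `a ∈ N^q(𝒳)`,
`j_t^* κ = 0` ((L)_t(q)), and `⟪L_t x, ξ⟫ = ⟪L_t x, a⟫ + ⟪x, L_t κ⟫ = 0` (symmetry of `L_t`, part XXIX-a).
[cite: Kleiman1968AlgebraicCycles, §3 (D(X))] [cite: VoisinHodgeI2002, Thm. 6.32 and §7.1.2] -/
theorem numerical₂_of_comap_le_sup_of_hodge (hf : IsCompactAbelianPencil f d) (t : ComplexPoints S) {p q : ℕ}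
    (hpq : p + q = d)
    (hq : ∀ c : complexBetti (fiberOver f t) (2 * q), IsRationalClass c →
      IsOfHodgeType d (fiberOver f t) (2 * q) q q c → c ∈ algebraicClasses (fiberOver f t) q)
    (hL : (algebraicClasses (fiberOver f t) q).comap (complexBetti.map (fiberι f t) (2 * q)).hom ≤
      algebraicClasses 𝒳 q ⊔ LinearMap.ker (complexBetti.map (fiberι f t) (2 * q)).hom) :
    ∀ x : complexBetti 𝒳 (2 * p),
      fiberGysin hf t p (complexBetti.map (fiberι f t) (2 * p) x) ∈ algebraicClasses 𝒳 (p + 1) →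
      (∀ w ∈ algebraicClasses 𝒳 q, cupProduct (show 2 * (p + 1) + 2 * q = 2 * (d + 1) by omega)
          (fiberGysin hf t p (complexBetti.map (fiberι f t) (2 * p) x)) w = 0) →
        fiberGysin hf t p (complexBetti.map (fiberι f t) (2 * p) x) = 0 := by
  intro x hx horth
  have h𝒳 := hf.isSmoothProjective_total
  have hXt := hf.isSmoothProjective_fiberOver t
  have hmem := algebraicClasses_le_span_hodgeClasses h𝒳 (p + 1) hx
  refine eq_zero_of_forall_cupProduct_span_hodge_eq_zero h𝒳 (show (p + 1) + q = d + 1 by omega) hmem fun ξ hξ ↦ ?_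
  -- `j_t^* ξ` is algebraic on the fibre
  have hξt : complexBetti.map (fiberι f t) (2 * q) ξ ∈ algebraicClasses (fiberOver f t) q := by
    refine (Submodule.span_le (p := (algebraicClasses (fiberOver f t) q).comap
      (complexBetti.map (fiberι f t) (2 * q)).hom)).2 ?_ hξ
    rintro c ⟨hcQ, hcH⟩
    exact hq _ (hcQ.map (AlgPoints.mapContinuous (L := ℂ) (fiberι f t))) (hcH.map_of_isSmoothProjective hXt h𝒳 (fiberι f t))
  obtain ⟨a, ha, κ, hκ, haκ⟩ := Submodule.mem_sup.1 (hL hξt)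
  have hκ' : complexBetti.map (fiberι f t) (2 * q) κ = 0 := LinearMap.mem_ker.1 hκ
  rw [← haκ, map_add, horth a ha, zero_add, cupProduct_fiberGysin_map_fiberι_eq_zero_iff hf t hpq x κ, hκ', map_zero,
    map_zero]

/-! ## §2 Division from the pair of lifts, at a fibre satisfying the Hodge conjecture -/

/-- **`HC^p(𝒳_t) ∧ HC^q(𝒳_t) ⊢ (L)_t(p) ∧ (L)_t(q) ⟹ Div[t, p]`** (`p + q = d`): part XXIX-a with (Num₁) from part XVIII-c's
`numerical_of_comap_le_sup_of_hodge` and (Num₂) from §1. [cite: Kleiman1968AlgebraicCycles, §3 (D(X))]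
[cite: Milne2020HodgeClassesAV, Prop. 1 (p. 7)] -/
theorem fibreClassDivisionAt_of_comap_le_sup_pair_of_hodge (hf : IsCompactAbelianPencil f d) (t : ComplexPoints S)
    {p q : ℕ} (hpq : p + q = d)
    (hp : ∀ c : complexBetti (fiberOver f t) (2 * p), IsRationalClass c →
      IsOfHodgeType d (fiberOver f t) (2 * p) p p c → c ∈ algebraicClasses (fiberOver f t) p)
    (hq : ∀ c : complexBetti (fiberOver f t) (2 * q), IsRationalClass c →
      IsOfHodgeType d (fiberOver f t) (2 * q) q q c → c ∈ algebraicClasses (fiberOver f t) q)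
    (hLp : (algebraicClasses (fiberOver f t) p).comap (complexBetti.map (fiberι f t) (2 * p)).hom ≤
      algebraicClasses 𝒳 p ⊔ LinearMap.ker (complexBetti.map (fiberι f t) (2 * p)).hom)
    (hLq : (algebraicClasses (fiberOver f t) q).comap (complexBetti.map (fiberι f t) (2 * q)).hom ≤
      algebraicClasses 𝒳 q ⊔ LinearMap.ker (complexBetti.map (fiberι f t) (2 * q)).hom) :
    Div[hf, t, p] :=
  fibreClassDivisionAt_of_numerical hf t hpq
    (fun _ hw h ↦ numerical_of_comap_le_sup_of_hodge hf t hpq hp hLp _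
      (algebraicClasses_sup_ker_le_comap hf q t (Submodule.mem_sup_left hw)) h)
    (numerical₂_of_comap_le_sup_of_hodge hf t hpq hq hLq)

/-- **`HC^p(𝒳_t) ∧ HC^q(𝒳_t) ∧ (L)_t(q) ⊢ Div[t, p] ⟺ (L)_t(p)`.** [cite: Kleiman1968AlgebraicCycles, §3 (D(X))]
[cite: Milne2020HodgeClassesAV, Prop. 1 (p. 7)] -/
theorem fibreClassDivisionAt_iff_comap_le_sup_of_hodge (hf : IsCompactAbelianPencil f d) (t : ComplexPoints S)
    {p q : ℕ} (hpq : p + q = d)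
    (hp : ∀ c : complexBetti (fiberOver f t) (2 * p), IsRationalClass c →
      IsOfHodgeType d (fiberOver f t) (2 * p) p p c → c ∈ algebraicClasses (fiberOver f t) p)
    (hq : ∀ c : complexBetti (fiberOver f t) (2 * q), IsRationalClass c →
      IsOfHodgeType d (fiberOver f t) (2 * q) q q c → c ∈ algebraicClasses (fiberOver f t) q)
    (hLq : (algebraicClasses (fiberOver f t) q).comap (complexBetti.map (fiberι f t) (2 * q)).hom ≤
      algebraicClasses 𝒳 q ⊔ LinearMap.ker (complexBetti.map (fiberι f t) (2 * q)).hom) :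
    Div[hf, t, p] ↔ (algebraicClasses (fiberOver f t) p).comap (complexBetti.map (fiberι f t) (2 * p)).hom ≤
      algebraicClasses 𝒳 p ⊔ LinearMap.ker (complexBetti.map (fiberι f t) (2 * p)).hom :=
  ⟨comap_le_sup_of_fibreClassDivisionAt hf, fun hLp ↦ fibreClassDivisionAt_of_comap_le_sup_pair_of_hodge hf t hpq hp hq hLp hLq⟩

/-- **AT A FIBRE SATISFYING THE HODGE CONJECTURE IN EVERY DEGREE: [∀ p, Div[t, p]] ⟺ [∀ p, (L)_t(p)]** — division by the
fibre class in all degrees is exactly the lift in all degrees. (Degrees `p > d` are vacuous on both sides.)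
[cite: Kleiman1968AlgebraicCycles, §3 (D(X))] [cite: Milne2020HodgeClassesAV, Prop. 1 (p. 7)] -/
theorem forall_fibreClassDivisionAt_iff_forall_comap_le_sup_of_hodge (hf : IsCompactAbelianPencil f d) (t : ComplexPoints S)
    (hHC : ∀ (p : ℕ) (c : complexBetti (fiberOver f t) (2 * p)), IsRationalClass c →
      IsOfHodgeType d (fiberOver f t) (2 * p) p p c → c ∈ algebraicClasses (fiberOver f t) p) :
    (∀ p : ℕ, Div[hf, t, p]) ↔ ∀ p : ℕ,
      (algebraicClasses (fiberOver f t) p).comap (complexBetti.map (fiberι f t) (2 * p)).hom ≤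
        algebraicClasses 𝒳 p ⊔ LinearMap.ker (complexBetti.map (fiberι f t) (2 * p)).hom := by
  refine ⟨fun h p ↦ comap_le_sup_of_fibreClassDivisionAt hf (h p), fun h p ↦ ?_⟩
  rcases Nat.lt_or_ge d p with hp | hp
  · exact fibreClassDivisionAt_of_lt hf hp t
  · exact fibreClassDivisionAt_of_comap_le_sup_pair_of_hodge hf t (show p + (d - p) = d by omega) (hHC p) (hHC (d - p))
      (h p) (h (d - p))

/-! ## §3 CM fibres under `HC_CM`: Div^CM ⟺ (L); exactness rows -/

/-- **`HC_CM ⊢` at a CM fibre: [∀ p, Div[t, p]] ⟺ [∀ p, (L)_t(p)]** (`HC_CM` a BINDER; it supplies the Hodge conjecture of the CM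
fibre through the chart of `cmLocus`, part XIX-f). [cite: Andre1996Motifs, §6.3 a) (p. 33)] [cite: Kleiman1968AlgebraicCycles, §3 (D(X))] -/
theorem forall_fibreClassDivisionAt_iff_forall_comap_le_sup_of_HC_CM (hCM : RankFourFaces.CMAbelianHodge)
    (hf : IsCompactAbelianPencil f d) {t : ComplexPoints S} (ht : t ∈ cmLocus f d) :
    (∀ p : ℕ, Div[hf, t, p]) ↔ ∀ p : ℕ,
      (algebraicClasses (fiberOver f t) p).comap (complexBetti.map (fiberι f t) (2 * p)).hom ≤
        algebraicClasses 𝒳 p ⊔ LinearMap.ker (complexBetti.map (fiberι f t) (2 * p)).hom := by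
  obtain ⟨A₀, ⟨e₀⟩, hdim, hcm⟩ := ht
  exact forall_fibreClassDivisionAt_iff_forall_comap_le_sup_of_hodge hf t
    fun p c hc hcpp ↦ Ring2Transport.mem_algebraicClasses_of_cmChart hCM A₀ e₀ hdim hcm hc hcpp

/-- **`HC_CM ⊢ Div^CM ⟺ (L)`**: "(Div) in every degree at every CM point of every compact abelian pencil" is EQUIVALENT, granted
`HC_CM` (BINDER), to the André-axis lift node `CMFibreAlgebraicLift` of part IV. [cite: Andre1996Motifs, Lemme 6.3.1 (p. 31) and §6.3 a)]
[cite: Milne2020HodgeClassesAV, Prop. 1 (p. 7)] -/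
theorem fibreClassDivisionCM_iff_cmFibreAlgebraicLift_of_HC_CM (hCM : RankFourFaces.CMAbelianHodge) :
    (∀ ⦃d : ℕ⦄ ⦃𝒳 S : SchemeOver ℂ⦄ (f : 𝒳 ⟶ S) (hf : IsCompactAbelianPencil f d) (p : ℕ), ∀ t ∈ cmLocus f d,
      Submodule.comap ((fiberGysin hf t p) ∘ₗ (complexBetti.map (fiberι f t) (2 * p)).hom) (algebraicClasses 𝒳 (p + 1)) ≤
        algebraicClasses 𝒳 p ⊔ LinearMap.ker (complexBetti.map (fiberι f t) (2 * p)).hom) ↔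
    CMFibreAlgebraicLift := by
  rw [cmFibreAlgebraicLift_iff_comap_le_sup]
  refine ⟨fun h d 𝒳 S f hf p t ht ↦ comap_le_sup_of_fibreClassDivisionAt hf (h f hf p t ht), fun h d 𝒳 S f hf p t ht ↦ ?_⟩
  exact (forall_fibreClassDivisionAt_iff_forall_comap_le_sup_of_HC_CM hCM hf ht).2 (fun p' ↦ h f hf p' t ht) p

/-- **`HC_AV ⟹ Div^CM` granted Verdier** (through `HC_AV ⟹ HC_CM` and part XX-a's `cmFibreAlgebraicLift_of_HC_AV_of_verdier`).
[cite: Verdier1976, Cor. (5.1)] [cite: Andre1996Motifs, §5.1 (p. 25)] -/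
theorem fibreClassDivisionCM_of_HC_AV_of_verdier (hGT : Verdier1976_genericLocalTriviality)
    (h : PadicSemiregularLift.HodgeAbelianVarieties) :
    ∀ ⦃d : ℕ⦄ ⦃𝒳 S : SchemeOver ℂ⦄ (f : 𝒳 ⟶ S) (hf : IsCompactAbelianPencil f d) (p : ℕ), ∀ t ∈ cmLocus f d,
      Submodule.comap ((fiberGysin hf t p) ∘ₗ (complexBetti.map (fiberι f t) (2 * p)).hom) (algebraicClasses 𝒳 (p + 1)) ≤
        algebraicClasses 𝒳 p ⊔ LinearMap.ker (complexBetti.map (fiberι f t) (2 * p)).hom :=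
  (fibreClassDivisionCM_iff_cmFibreAlgebraicLift_of_HC_CM (HC_CM_of_HC_AV h)).2 (cmFibreAlgebraicLift_of_HC_AV_of_verdier hGT h)

/-- **EXACTNESS OF (Div), granted Lemme 6.3.1 and Verdier: `HC_AV ⟺ HC_CM ∧ Div^CM`.** `h₂₁`, Verdier BINDERS; `HC_CM` inside the
`↔`. research route, not a corollary; conditional on HC_CM plus one named minimal statement.
[cite: Andre1996Motifs, Lemme 6.3.1 (p. 31) and Remarque 2 (p. 33)] [cite: Verdier1976, Cor. (5.1)] -/
theorem HC_AV_iff_HC_CM_and_fibreClassDivisionCM_of_verdier (h₂₁ : andre1996_cmAnchoredPencil)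
    (hGT : Verdier1976_genericLocalTriviality) :
    PadicSemiregularLift.HodgeAbelianVarieties ↔ (RankFourFaces.CMAbelianHodge ∧
      ∀ ⦃d : ℕ⦄ ⦃𝒳 S : SchemeOver ℂ⦄ (f : 𝒳 ⟶ S) (hf : IsCompactAbelianPencil f d) (p : ℕ), ∀ t ∈ cmLocus f d,
        Submodule.comap ((fiberGysin hf t p) ∘ₗ (complexBetti.map (fiberι f t) (2 * p)).hom) (algebraicClasses 𝒳 (p + 1)) ≤
          algebraicClasses 𝒳 p ⊔ LinearMap.ker (complexBetti.map (fiberι f t) (2 * p)).hom) :=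
  ⟨fun h ↦ ⟨HC_CM_of_HC_AV h, fibreClassDivisionCM_of_HC_AV_of_verdier hGT h⟩,
    fun h ↦ HC_AV_of_HC_CM_of_fibreClassDivision h₂₁ h.1 h.2⟩

/-- **The reduction item in division form, granted Lemme 6.3.1 and Verdier: `CMToAbelian ⟺ (HC_CM → Div^CM)`.** Nothing closes the
item. [cite: Andre1996Motifs, Remarque 2 (p. 33)] [cite: Verdier1976, Cor. (5.1)] -/
theorem cmToAbelian_iff_HC_CM_imp_fibreClassDivisionCM_of_verdier (h₂₁ : andre1996_cmAnchoredPencil)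
    (hGT : Verdier1976_genericLocalTriviality) :
    RankFourFaces.CMToAbelian ↔ (RankFourFaces.CMAbelianHodge →
      ∀ ⦃d : ℕ⦄ ⦃𝒳 S : SchemeOver ℂ⦄ (f : 𝒳 ⟶ S) (hf : IsCompactAbelianPencil f d) (p : ℕ), ∀ t ∈ cmLocus f d,
        Submodule.comap ((fiberGysin hf t p) ∘ₗ (complexBetti.map (fiberι f t) (2 * p)).hom) (algebraicClasses 𝒳 (p + 1)) ≤
          algebraicClasses 𝒳 p ⊔ LinearMap.ker (complexBetti.map (fiberι f t) (2 * p)).hom) := by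
  rw [cmToAbelian_iff_HC_CM_imp_cmFibreAlgebraicLift_of_verdier h₂₁ hGT]
  exact ⟨fun h hCM ↦ (fibreClassDivisionCM_iff_cmFibreAlgebraicLift_of_HC_CM hCM).2 (h hCM),
    fun h hCM ↦ (fibreClassDivisionCM_iff_cmFibreAlgebraicLift_of_HC_CM hCM).1 (h hCM)⟩

end Summit.HodgeConjecture.HodgeConjecture.Ring2.AbelianAll

end
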